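import Literature.MathematicalPhysics.QuantumFieldTheory.Balaban1983to89.B4Thm19BoxHolderCut
import Literature.MathematicalPhysics.QuantumFieldTheory.Balaban1983to89.B4Thm110BoxDerivUniform
import Literature.MathematicalPhysics.QuantumFieldTheory.Balaban1983to89.B4Thm19BoxHolderAll

/-!
# `Balaban1983to89.B4Thm19BoxHolderUniform` — [Balaban1983RegularityDecay] THEOREM p. 573, (1.9) THE HÖLDER MEMBER on a
# box, HYPOTHESIS-FREE for a (1.7)-regular field constant near `∂Ω`, «e sufficiently small» UNIFORM IN `Ω`, all pairs
# (the print's cut cubes; discharge of the per-cube inputs of `B4Thm19BoxHolderCut` on the sub-boxes of sides `≤ 2K`)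

statement-level skeleton of published theorems with citation tags; proofs where landed; nothing here is a claim about the Yang–Mills mass gap

CITATION HEADER.  T. Bałaban, *Regularity and decay of lattice Green's functions*, Commun. Math. Phys. **89** (1983)
571–597, doi:10.1007/bf01214744 [Balaban1983RegularityDecay] (cell paper B4; held text
`paper:balaban1983-cmp89-regularity-decay`, journal page = PDF page + 570; pp. 572–573, 575–579, 581).  Unit `lit-balaban-p17`
gen 5 (Phase-2 proof seat p17; HOME `run/shared/lean/pub/lit-balaban/`), SKELETON row **B4.Thm@573** ((1.9), rectangular
`Ω`).  Imports p17 g5 `B4Thm19BoxHolderCut` (`thm19_holder_boxCut_cubeField`), `B4Thm110BoxDerivUniform`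
(`thm110_deriv_box_uniform`; → `B4Thm110BoxUniform`: `IsInt`, `baseVal`, `regular_shift`, `face_const`) and p17 g4
`B4Thm19BoxHolderAll` (`rpow_le_max_one`, `abs_U_mulVec_apply_le`; → `B4Thm19BoxHolderRegular`: `const_inputs_holder`,
`transport_congr_nbrs`; p35 g6 `B4Lemma22HolderCubeField.lemma22_holder_cubeField`).

WHAT IS PRINTED.  p. 573 (1.9) «For α < 1 there exist positive constants δ₀, c₀, R₀ independent of A, k, Ω … such that
for e sufficiently small … |x − x′|^{−α}|U(A(Γ_{x,x′}))(D^η_{A,μ}G_k(Ω,A)f)(x′) − (D^η_{A,μ}G_k(Ω,A)f)(x)| ≤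
c₀exp(−δ₀dist({x,x′}, supp f))‖f‖_∞ … for rectangular parallelepipeds, the inequalities hold without any restrictions
on the points»; p. 578 «If |x′ − x| > 1, then this inequality is a simple consequence of the corresponding inequality
for the derivative only».

WHAT THIS MODULE PROVES (all in full; `Ω = Box d ℓ k Mb`, `d ≥ 1`).
* **`thm19_holder_box_uniform`** — (1.9) for close pairs (`32|x′−x|_∞ ≤ nK`) on a box, HYPOTHESIS-FREE: `∃ K` (`16 ≤ K`,
  `4 ∣ K`), `∃ c₁ > 0`, `∀ (c, β)` `∃ e₁ > 0` — BEFORE the box —, for every `k ≥ 1`, `(a, m²)` in the window, EVERY box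
  with `K ∣ Mb_μ`, every (1.7)-regular component field constant (`= A(0)`) on the collar of width `K` at `∂Ω` with
  `0 < e ≤ e₁`, every pair/chain as in `B4Thm19BoxHolderCut`, every `f` supported at sup-distance `≥ D` from `x`:
  `(n/r)^α|U(A(Γ))(D^η_{A,μ}G_k(Ω,A)f)(x′) − (D^η_{A,μ}G_k(Ω,A)f)(x)|_i ≤ c₁e^{−D/K}‖f‖_∞`.
* **`thm19_holder_box_uniform_all`** — THE SAME FOR ALL PAIRS `x ≠ x′` (far pairs by the uniform derivative member
  `thm110_deriv_box_uniform` and `(n/r)^α ≤ 2`, p. 578), `f` supported at sup-distance `≥ D ≥ 0` from both `x` and `x′`.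
  Compared with p17 g4's `B4Thm19BoxHolderAll.thm19_holder_box_regular_all` the box-size bound `S` is GONE from «e
  sufficiently small»: every per-cube input lives on a cut cube of sides `≤ 2K` (interior: p35's Lemma 2.2 (2.16)/(2.17)
  and (2.20) with base value `A(corner of □_j)`; face: the constant configuration, `const_inputs(_deriv/_holder)`).
HONEST SCOPE.  (i) `0 ≤ α < 1` (the print's «α < 1»; negative `α` is not treated); (ii) `d ≥ 1`; (iii) the lineage's
(1.6); (iv) `A = A(0)` on the collar of width `K` at `∂Ω` (HOME/GAPS.md G-B4-p17-02); (v) the constant is uniform in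
`η`, `Ω`, `A`; `K`, `c₁` depend on `(d, N, flow Lipschitz constant, L, a₋, a₊, m²₊, α)`, `e₁` on these and `(c, β)`.
No `def`, no `Prop` fact, no `sorry`; axioms standard.
-/

namespace Literature.MathematicalPhysics.QuantumFieldTheory.Balaban1983to89.B4Thm19BoxHolderUniform

open Literature.MathematicalPhysics.QuantumFieldTheory.Balaban1983to89.B4Reflection242 (boxDom nbrs mem_nbrs)
open Literature.MathematicalPhysics.QuantumFieldTheory.Balaban1983to89.B4GaugeCovariance
open Literature.MathematicalPhysics.QuantumFieldTheory.Balaban1983to89.B4Commutators25to211 (mulH)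
open Literature.MathematicalPhysics.QuantumFieldTheory.Balaban1983to89.B4Lower18Regular (e1 lsum baseEmb stairContour
  transport_fieldLink)
open Literature.MathematicalPhysics.QuantumFieldTheory.Balaban1983to89.B4Lower18RegularRegion (compField)
open Literature.MathematicalPhysics.QuantumFieldTheory.Balaban1983to89.B4Lemma21Region (siteNorm covDeriv)
open Literature.MathematicalPhysics.QuantumFieldTheory.Balaban1983to89.B4Lemma22ReduceZero (Box opA greenA derivA)
open Literature.MathematicalPhysics.QuantumFieldTheory.Balaban1983to89.B4Lemma22Reduce231 (supN supN_nonneg)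
open Literature.MathematicalPhysics.QuantumFieldTheory.Balaban1983to89.B4PartitionUnity22 (hprof D1 D2 D1_nonneg D2_nonneg
  contDiff_hprof hasCompactSupport_hprof)
open Literature.MathematicalPhysics.QuantumFieldTheory.Balaban1983to89.B4ContourShift (supNorm supNorm_nonneg)
open Literature.MathematicalPhysics.QuantumFieldTheory.Balaban1983to89.B4Eq220PartitionSizes (hBox)
open Literature.MathematicalPhysics.QuantumFieldTheory.Balaban1983to89.B4Eq220CommutatorField (kOp)
open Literature.MathematicalPhysics.QuantumFieldTheory.Balaban1983to89.B4Lemma22HolderBox (IsNNChain)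
open Literature.MathematicalPhysics.QuantumFieldTheory.Balaban1983to89.B4Lemma22HolderCubeField (lemma22_holder_cubeField)
open Literature.MathematicalPhysics.QuantumFieldTheory.Balaban1983to89.B4CubeFields22 (cubeField)
open Literature.MathematicalPhysics.QuantumFieldTheory.Balaban1983to89.B4Eq220CubeField (eq220_cubeField
  lemma22_sup_cubeField)
open Literature.MathematicalPhysics.QuantumFieldTheory.Balaban1983to89.B4BoxCubeGeometry (posR cubeLo cubeMs cube_ho)
open Literature.MathematicalPhysics.QuantumFieldTheory.Balaban1983to89.B4HolderChainTools (one_le_supNorm_of_ne)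
open Literature.MathematicalPhysics.QuantumFieldTheory.Balaban1983to89.B4Thm110BoxDerivWalk (row_abs_sum_U_le)
open Literature.MathematicalPhysics.QuantumFieldTheory.Balaban1983to89.B4Thm110BoxRegular (const_inputs greenA_congr_bonds
  kOp_congr_bonds)
open Literature.MathematicalPhysics.QuantumFieldTheory.Balaban1983to89.B4Thm110BoxDerivRegular (const_inputs_deriv
  derivA_congr_bonds)
open Literature.MathematicalPhysics.QuantumFieldTheory.Balaban1983to89.B4Thm19BoxHolderRegular (const_inputs_holder
  transport_congr_nbrs)
open Literature.MathematicalPhysics.QuantumFieldTheory.Balaban1983to89.B4Thm19BoxHolderAll (rpow_le_max_one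
  abs_U_mulVec_apply_le)
open Literature.MathematicalPhysics.QuantumFieldTheory.Balaban1983to89.B4Thm110BoxCut
open Literature.MathematicalPhysics.QuantumFieldTheory.Balaban1983to89.B4Thm110BoxUniform (IsInt baseVal baseVal_of_isInt
  baseVal_of_not_isInt regular_shift face_const)
open Literature.MathematicalPhysics.QuantumFieldTheory.Balaban1983to89.B4Thm110BoxDerivUniform (thm110_deriv_box_uniform)
open Literature.MathematicalPhysics.QuantumFieldTheory.Balaban1983to89.B4Thm19BoxHolderCut (thm19_holder_boxCut_cubeField)
open scoped Matrix

noncomputable section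

variable {d : ℕ}
variable {ι : Type} [Fintype ι] [DecidableEq ι]

/-! v2 (p17 g5, G-B4-p17-03): the large-cube modulus `K` of both theorems is now chosen BEFORE `α`
(`thm19_holder_box_uniform_unifK`, `thm19_holder_box_uniform_all_unifK`: `∃ K ∀ α ∃ c₁ …`, the proofs of v1 with
`α` introduced after `K`); v1's statements are kept as corollaries.  Nothing else changed. -/

/-! ## §1. (1.9) on a box for close pairs, hypothesis-free, uniform in `Ω` -/

/-- (v2, G-B4-p17-03: the large-cube modulus `K` CHOSEN BEFORE `α` — the witness `K = 16(⌈X⌉₊+1)` of v1's proof is `α`-free; quantifiers `∃ K ∀ α ∃ c₁`, otherwise verbatim.) **THEOREM (1.9) OF [B4] ON A BOX, HÖLDER MEMBER, CLOSE PAIRS — FOR A (1.7)-REGULAR FIELD CONSTANT NEAR `∂Ω`, WITH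
«e SUFFICIENTLY SMALL» UNIFORM IN `Ω`, THE CONSTANT UNIFORM IN `η`** (pp.573–579, p.581; the print's cut cubes): for
`0 ≤ α < 1` there are `K` (`16 ≤ K`, `4 ∣ K`) and `c₁ > 0` such that for all `c ≥ 0`, `β > 0` there is `e₁ > 0` with —
for every `k ≥ 1`, `(a,m²) ∈ [a₋,a₊]×[0,m²₊]`, EVERY box `Ω = Π[0, nMb_μ)` (`K ∣ Mb_μ`, `1 ≤ Mb_μ`), component field `A`
with `|A_ν(x+e_μ) − A_ν(x)| ≤ c·e^{β−1}η` on `Ω` and `A = A(0)` on the `K`-collar at `∂Ω`, `0 < e ≤ e₁`, direction `μ`,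
fine sites `x ≠ x′` with `x+e_μ, x′+e_μ ∈ Ω`, `32|x′−x|_∞ ≤ nK`, a nearest-neighbour chain `Γ` from `x` to `x′` of length
`≤ (d+1)|x′−x|_∞` inside the `|x′−x|_∞`-ball about `x`, every `P` at unit-lattice sup-distance `≥ D` from `x`, every `f`
supported in `P` with `|f| ≤ φ` — `(n/|x′−x|_∞)^α·|U(A(Γ))(D^η_{A,μ}G_k(Ω,A)f)(x′) − (D^η_{A,μ}G_k(Ω,A)f)(x)|_i ≤
c₁·e^{−D/K}·φ`. [cite: Balaban1983RegularityDecay, Theorem (1.9) p.573; pp.575–579, p.581] -/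
theorem thm19_holder_box_uniform_unifK (F : OrthFlow ι) {ℓ₁ : ℝ} (hℓ₁ : 0 ≤ ℓ₁)
    (hLip : ∀ t (v : ι → ℝ), ((F.U t - 1) *ᵥ v) ⬝ᵥ ((F.U t - 1) *ᵥ v) ≤ (ℓ₁ * t) ^ 2 * (v ⬝ᵥ v))
    (d ℓ : ℕ) (hd : 1 ≤ d) (hℓ : 1 ≤ ℓ) (amin aplus m2plus : ℝ) (ha : 0 < amin) :
    ∃ K : ℕ, 16 ≤ K ∧ 4 ∣ K ∧ ∀ (α : ℝ), 0 ≤ α → α < 1 → ∃ c₁ : ℝ, 0 < c₁ ∧ ∀ (creg β : ℝ), 0 ≤ creg → 0 < β →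
      ∃ e₁ : ℝ, 0 < e₁ ∧ ∀ (k : ℕ), 1 ≤ k → ∀ (hn : 1 ≤ (ℓ + 1) ^ k) (a m2 : ℝ),
      amin ≤ a → a ≤ aplus → 0 ≤ m2 → m2 ≤ m2plus →
      ∀ (Mb : Fin (d + 1) → ℕ), (∀ i, 1 ≤ Mb i) → (∀ μ, K ∣ Mb μ) →
      ∀ (Ac : (Fin (d + 1) → ℤ) → Fin (d + 1) → ℝ) (e : ℝ), 0 < e → e ≤ e₁ →
        (∀ x ∈ Box d ℓ k Mb, ∀ μ ν : Fin (d + 1),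
          |Ac (x + e1 μ) ν - Ac x ν| ≤ creg * e ^ (β - 1) / ((ℓ + 1) ^ k : ℕ)) →
        (∀ w ∈ Box d ℓ k Mb, (∃ μ, w μ < (((ℓ + 1) ^ k : ℕ) : ℤ) * K ∨
            (((ℓ + 1) ^ k : ℕ) : ℤ) * Mb μ < w μ + (((ℓ + 1) ^ k : ℕ) : ℤ) * K) → ∀ ν, Ac w ν = Ac 0 ν) →
      ∀ (μ : Fin (d + 1)) (x x' : ↥(Box d ℓ k Mb)), x.1 + e1 μ ∈ Box d ℓ k Mb → x'.1 + e1 μ ∈ Box d ℓ k Mb →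
        x'.1 ≠ x.1 → 32 * supNorm (x'.1 - x.1) ≤ (((ℓ + 1) ^ k : ℕ) : ℝ) * K →
      ∀ (l : List ↥(Box d ℓ k Mb)), IsNNChain x l → pathEnd x l = x' →
        (l.length : ℝ) ≤ ((d : ℝ) + 1) * supNorm (x'.1 - x.1) →
        (∀ z ∈ l, supNorm (z.1 - x.1) ≤ supNorm (x'.1 - x.1)) →
      ∀ (P : ↥(Box d ℓ k Mb) → Prop) [DecidablePred P] (D : ℝ),
        (∀ x'', P x'' → ∃ ν, D ≤ |posR ℓ k Mb x ν - posR ℓ k Mb x'' ν|) →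
      ∀ (f : ↥(Box d ℓ k Mb) × ι → ℝ), (∀ p, ¬ P p.1 → f p = 0) → ∀ (φ : ℝ), 0 ≤ φ → (∀ p, |f p| ≤ φ) →
      ∀ i : ι,
        ((((ℓ + 1) ^ k : ℕ) : ℝ) / supNorm (x'.1 - x.1)) ^ α *
          |(transport (fieldLink F (e / ((ℓ + 1) ^ k : ℕ)) (fun u v : ↥(Box d ℓ k Mb) => compField Ac u.1 v.1)) x l
              *ᵥ fld (derivA d F (e / ((ℓ + 1) ^ k : ℕ)) ℓ k Mb (fun u v : ↥(Box d ℓ k Mb) => compField Ac u.1 v.1) μ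
                    *ᵥ (greenA d F (e / ((ℓ + 1) ^ k : ℕ)) ℓ k a m2 Mb (baseEmb hn Mb) (stairContour hn Mb)
                        (fun u v : ↥(Box d ℓ k Mb) => compField Ac u.1 v.1) *ᵥ f)) x'
            - fld (derivA d F (e / ((ℓ + 1) ^ k : ℕ)) ℓ k Mb (fun u v : ↥(Box d ℓ k Mb) => compField Ac u.1 v.1) μ
                    *ᵥ (greenA d F (e / ((ℓ + 1) ^ k : ℕ)) ℓ k a m2 Mb (baseEmb hn Mb) (stairContour hn Mb)
                        (fun u v : ↥(Box d ℓ k Mb) => compField Ac u.1 v.1) *ᵥ f)) x) i|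
          ≤ c₁ * Real.exp (-(D / K)) * φ := by
  obtain ⟨C₁, hC₁, h₁⟩ := lemma22_sup_cubeField F hℓ₁ hLip d ℓ hℓ amin aplus m2plus ha
  obtain ⟨C₂, hC₂, h₂⟩ := eq220_cubeField F hℓ₁ hLip d ℓ hℓ amin aplus m2plus ha
  obtain ⟨cG₀, cK₀, hcG₀, hcK₀, h₀⟩ := const_inputs F hℓ₁ hLip d ℓ hℓ amin aplus m2plus ha
  obtain ⟨cD₀, hcD₀, h₀'⟩ := const_inputs_deriv F d ℓ hℓ amin aplus m2plus ha
  set X : ℝ := (3 : ℝ) ^ (d + 1) * Real.sqrt (Fintype.card ι) * (C₂ + cK₀) * Real.exp 1 with hX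
  have hX0 : 0 ≤ X := by positivity
  set K : ℕ := 16 * (⌈X⌉₊ + 1) with hK
  have hK16 : 16 ≤ K := by omega
  have h4 : 4 ∣ K := ⟨4 * (⌈X⌉₊ + 1), by omega⟩
  have hK2 : 2 ≤ K := by omega
  have hK1 : 1 ≤ K := by omega
  have hKr : (0 : ℝ) < K := by exact_mod_cast hK1
  have hKX : X ≤ K := by
    refine (Nat.le_ceil X).trans ?_
    rw [hK]
    push_cast
    linarith [(Nat.cast_nonneg ⌈X⌉₊ : (0 : ℝ) ≤ ⌈X⌉₊)]
  refine ⟨K, hK16, h4, fun α hα0 hα1 => ?_⟩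
  obtain ⟨C₃, hC₃, h₃⟩ := lemma22_holder_cubeField F hℓ₁ hLip d ℓ hℓ amin aplus m2plus ha α hα0 hα1
  obtain ⟨cH₀, hcH₀, h₀''⟩ := const_inputs_holder F hℓ₁ hLip d ℓ hℓ amin aplus m2plus ha α hα0 hα1
  set cG : ℝ := max C₁ cG₀ with hcG_def
  set cD : ℝ := max C₁ cD₀ with hcD_def
  set cH : ℝ := max C₃ cH₀ with hcH_def
  set cK : ℝ := (C₂ + cK₀) / K with hcK_def
  have hcG : 0 ≤ cG := hC₁.le.trans (le_max_left _ _)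
  have hcD : 0 ≤ cD := hC₁.le.trans (le_max_left _ _)
  have hcH : 0 ≤ cH := hC₃.le.trans (le_max_left _ _)
  have hcK : 0 ≤ cK := div_nonneg (by positivity) hKr.le
  have h3 : (3 : ℝ) ^ (d + 1) * (Real.sqrt (Fintype.card ι) * cK) ≤ Real.exp (-1) := by
    have hexp : Real.exp 1 * Real.exp (-1) = 1 := by rw [← Real.exp_add]; norm_num
    have e : (3 : ℝ) ^ (d + 1) * (Real.sqrt (Fintype.card ι) * cK) = X / K * Real.exp (-1) := by
      rw [hcK_def, hX]
      calc (3 : ℝ) ^ (d + 1) * (Real.sqrt (Fintype.card ι) * ((C₂ + cK₀) / K))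
          = (3 : ℝ) ^ (d + 1) * Real.sqrt (Fintype.card ι) * (C₂ + cK₀) / K * (Real.exp 1 * Real.exp (-1)) := by
            rw [hexp]; ring
        _ = (3 : ℝ) ^ (d + 1) * Real.sqrt (Fintype.card ι) * (C₂ + cK₀) * Real.exp 1 / K * Real.exp (-1) := by
            ring
    rw [e]
    have : X / K ≤ 1 := div_le_one_of_le₀ hKX (Nat.cast_nonneg K)
    calc X / K * Real.exp (-1) ≤ 1 * Real.exp (-1) := mul_le_mul_of_nonneg_right this (Real.exp_pos _).le
      _ = Real.exp (-1) := one_mul _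
  have hD1 := D1_nonneg contDiff_hprof hasCompactSupport_hprof
  have hD2 := D2_nonneg contDiff_hprof hasCompactSupport_hprof
  set c₁ : ℝ := 2 ^ (d + 4) * Real.exp (5 / 2)
    * (Real.sqrt (Fintype.card ι) * (cH + ((d : ℝ) + 1) * D1 hprof * cD
        + ((d : ℝ) + 3) * (((d : ℝ) + 1) * (D1 hprof + D2 hprof)) * cD
        + ((d : ℝ) + 1) * (D1 hprof ^ 2 + D2 hprof) * cG)) + 1 with hc₁
  refine ⟨c₁, by positivity, fun creg β hcreg hβ => ?_⟩
  -- the thresholds at the side bound `2K` of the cut cubes — uniform in `Ω`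
  obtain ⟨e₁, he₁, h₁'⟩ := h₁ creg β hcreg hβ (2 * K) K hK1
  obtain ⟨e₂, he₂, h₂'⟩ := h₂ creg β hcreg hβ (2 * K) K hK2
  obtain ⟨e₃, he₃, h₃'⟩ := h₃ creg β hcreg hβ (2 * K) K hK1
  refine ⟨min (min e₁ e₂) e₃, lt_min (lt_min he₁ he₂) he₃, ?_⟩
  intro k hk hn a m2 ea1 ea2 em1 em2 Mb hM hKM Ac e he hle h17 hcol μ x x' hxμ hx'μ hne hclose l hl hlend hlen
    hlnear P _ D hD f hfP φ hφ hf i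
  have hle1 : e ≤ e₁ := hle.trans ((min_le_left _ _).trans (min_le_left _ _))
  have hle2 : e ≤ e₂ := hle.trans ((min_le_left _ _).trans (min_le_right _ _))
  have hle3 : e ≤ e₃ := hle.trans (min_le_right _ _)
  have hn2 : 2 ≤ (ℓ + 1) ^ k := by
    calc 2 ≤ ℓ + 1 := by omega
      _ = (ℓ + 1) ^ 1 := (pow_one _).symm
      _ ≤ (ℓ + 1) ^ k := Nat.pow_le_pow_right (Nat.succ_pos ℓ) hk
  have hnK : 16 ≤ (ℓ + 1) ^ k * K := by nlinarith
  have ha' : 0 < a := lt_of_lt_of_le ha ea1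
  have hcol' : ∀ w : ↥(Box d ℓ k Mb), (∃ μ, w.1 μ < (((ℓ + 1) ^ k : ℕ) : ℤ) * K ∨
      (((ℓ + 1) ^ k : ℕ) : ℤ) * Mb μ < w.1 μ + (((ℓ + 1) ^ k : ℕ) : ℤ) * K) → ∀ ν, Ac w.1 ν = Ac 0 ν :=
    fun w hw => hcol w.1 w.2 hw
  set AcS : (Fin (d + 1) → ℤ) → (Fin (d + 1) → ℤ) → Fin (d + 1) → ℝ :=
    fun j y => Ac (y + fun i => (((ℓ + 1) ^ k : ℕ) : ℤ) * (cubeLo Mb K j i : ℤ)) with hAcS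
  have hregS : ∀ j, ∀ y ∈ Box d ℓ k (cubeMs Mb K j), ∀ μ ν : Fin (d + 1),
      |AcS j (y + e1 μ) ν - AcS j y ν| ≤ creg * e ^ (β - 1) / ((ℓ + 1) ^ k : ℕ) :=
    fun j => regular_shift (Mb := Mb) (K := K) j h17
  have hbase : ∀ j, IsInt Mb K j → baseVal Mb K ((ℓ + 1) ^ k) Ac j = AcS j 0 := fun j hj => by
    rw [baseVal_of_isInt _ _ hj]
  have hMs1 : ∀ j ∈ labelsK Mb K, ∀ μ, 1 ≤ cubeMs Mb K j μ := fun j hj μ => one_le_cubeMs hK1 hKM hM hj μ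
  have hMsS : ∀ j ∈ labelsK Mb K, ∀ μ, cubeMs Mb K j μ ≤ 2 * K := fun j hj μ => cubeMs_le hK1 hKM hM hj μ
  have hMsK : ∀ j ∈ labelsK Mb K, ∀ μ, K ∣ cubeMs Mb K j μ := fun j hj μ => dvd_cubeMs hK1 hKM hM hj μ
  -- the per-cube inputs on the cut cubes
  have hG : ∀ j ∈ labelsK Mb K, ∀ Φ : ↥(Box d ℓ k (cubeMs Mb K j)) × ι → ℝ,
      supN (greenA d F (e / ((ℓ + 1) ^ k : ℕ)) ℓ k a m2 (cubeMs Mb K j) (baseEmb hn _) (stairContour hn _)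
          (cubeField (Box d ℓ k (cubeMs Mb K j)) ((ℓ + 1) ^ k) K (jloc j) (baseVal Mb K ((ℓ + 1) ^ k) Ac j)
            (AcS j)) *ᵥ Φ) ≤ cG * supN Φ := by
    intro j hj Φ
    by_cases hint : IsInt Mb K j
    · have hin := fun μ => cubeMs_interior hK1 hKM hM hj hint μ
      rw [hbase j hint]
      have hb := (h₁' k hk hn hnK a m2 ea1 ea2 em1 em2 (cubeMs Mb K j) (hMs1 j hj) (hMsS j hj) (jloc j)
        (fun μ => by rw [(hin μ).2]) (fun μ => by rw [(hin μ).1, (hin μ).2]; push_cast; omega)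
        (AcS j) e he hle1 (hregS j) Φ).1
      exact hb.trans (mul_le_mul_of_nonneg_right (le_max_left _ _) (supN_nonneg Φ))
    · rw [baseVal_of_not_isInt _ _ hint,
        greenA_congr_bonds F _ hn a m2 (cubeMs Mb K j) (face_const hK1 hKM Ac hj hint hcol')]
      exact ((h₀ k hk hn a m2 ea1 ea2 em1 em2 (cubeMs Mb K j) (hMs1 j hj) K (jloc j) hK2 (hMsK j hj) _ (Ac 0)).1 Φ).trans
        (mul_le_mul_of_nonneg_right (le_max_right _ _) (supN_nonneg Φ))
  have hDG : ∀ j ∈ labelsK Mb K, ∀ (ν : Fin (d + 1)) (Φ : ↥(Box d ℓ k (cubeMs Mb K j)) × ι → ℝ),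
      supN (derivA d F (e / ((ℓ + 1) ^ k : ℕ)) ℓ k (cubeMs Mb K j)
          (cubeField (Box d ℓ k (cubeMs Mb K j)) ((ℓ + 1) ^ k) K (jloc j) (baseVal Mb K ((ℓ + 1) ^ k) Ac j)
            (AcS j)) ν
        *ᵥ (greenA d F (e / ((ℓ + 1) ^ k : ℕ)) ℓ k a m2 (cubeMs Mb K j) (baseEmb hn _) (stairContour hn _)
          (cubeField (Box d ℓ k (cubeMs Mb K j)) ((ℓ + 1) ^ k) K (jloc j) (baseVal Mb K ((ℓ + 1) ^ k) Ac j)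
            (AcS j)) *ᵥ Φ)) ≤ cD * supN Φ := by
    intro j hj ν Φ
    by_cases hint : IsInt Mb K j
    · have hin := fun μ => cubeMs_interior hK1 hKM hM hj hint μ
      rw [hbase j hint]
      have hb := (h₁' k hk hn hnK a m2 ea1 ea2 em1 em2 (cubeMs Mb K j) (hMs1 j hj) (hMsS j hj) (jloc j)
        (fun μ => by rw [(hin μ).2]) (fun μ => by rw [(hin μ).1, (hin μ).2]; push_cast; omega)
        (AcS j) e he hle1 (hregS j) Φ).2 ν
      exact hb.trans (mul_le_mul_of_nonneg_right (le_max_left _ _) (supN_nonneg Φ))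
    · have hb := face_const (ℓ := ℓ) (k := k) hK1 hKM Ac hj hint hcol'
      rw [baseVal_of_not_isInt _ _ hint, derivA_congr_bonds F _ (cubeMs Mb K j) hb ν,
        greenA_congr_bonds F _ hn a m2 (cubeMs Mb K j) hb]
      exact (h₀' k hk hn a m2 ea1 ea2 em1 em2 (cubeMs Mb K j) (hMs1 j hj) _ (Ac 0) ν Φ).trans
        (mul_le_mul_of_nonneg_right (le_max_right _ _) (supN_nonneg Φ))
  have hKG : ∀ j ∈ labelsK Mb K, ∀ Φ : ↥(Box d ℓ k (cubeMs Mb K j)) × ι → ℝ,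
      supN (kOp F (e / ((ℓ + 1) ^ k : ℕ)) ((ℓ + 1) ^ k) (B1.aSeq a ((ℓ : ℝ) + 1) k) m2 (cubeMs Mb K j)
            (baseEmb hn _) (stairContour hn _)
            (cubeField (Box d ℓ k (cubeMs Mb K j)) ((ℓ + 1) ^ k) K (jloc j) (baseVal Mb K ((ℓ + 1) ^ k) Ac j) (AcS j))
            (hBox ((ℓ + 1) ^ k) K (cubeMs Mb K j) (jloc j))
          *ᵥ (greenA d F (e / ((ℓ + 1) ^ k : ℕ)) ℓ k a m2 (cubeMs Mb K j) (baseEmb hn _) (stairContour hn _)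
              (cubeField (Box d ℓ k (cubeMs Mb K j)) ((ℓ + 1) ^ k) K (jloc j) (baseVal Mb K ((ℓ + 1) ^ k) Ac j)
                (AcS j))
            *ᵥ (mulH (ι := ι) (hBox ((ℓ + 1) ^ k) K (cubeMs Mb K j) (jloc j)) *ᵥ Φ))) ≤ cK * supN Φ := by
    intro j hj Φ
    have hsplit : ∀ t : ℝ, 0 ≤ t → t ≤ C₂ + cK₀ → t / K * supN Φ ≤ cK * supN Φ := fun t _ ht =>
      mul_le_mul_of_nonneg_right (div_le_div_of_nonneg_right ht hKr.le) (supN_nonneg Φ)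
    by_cases hint : IsInt Mb K j
    · have hin := fun μ => cubeMs_interior hK1 hKM hM hj hint μ
      rw [hbase j hint]
      have hb := h₂' k hk hn hnK a m2 ea1 ea2 em1 em2 (cubeMs Mb K j) (hMs1 j hj) (hMsS j hj) (hMsK j hj) (jloc j)
        (fun μ => by rw [(hin μ).2]) (fun μ => by rw [(hin μ).1, (hin μ).2]; push_cast; omega)
        (AcS j) e he hle2 (hregS j) Φ
      exact hb.trans (hsplit C₂ hC₂.le (by linarith))
    · have hb := face_const (ℓ := ℓ) (k := k) hK1 hKM Ac hj hint hcol'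
      rw [baseVal_of_not_isInt _ _ hint, kOp_congr_bonds F _ hn a m2 (cubeMs Mb K j) hb,
        greenA_congr_bonds F _ hn a m2 (cubeMs Mb K j) hb]
      exact ((h₀ k hk hn a m2 ea1 ea2 em1 em2 (cubeMs Mb K j) (hMs1 j hj) K (jloc j) hK2 (hMsK j hj) _ (Ac 0)).2 Φ).trans
        (hsplit cK₀ hcK₀.le (by linarith))
  have hHG : ∀ j ∈ labelsK Mb K, ∀ (b b' : ↥(Box d ℓ k (cubeMs Mb K j)))
      (hbμ : b.1 + e1 μ ∈ Box d ℓ k (cubeMs Mb K j)) (hb'μ : b'.1 + e1 μ ∈ Box d ℓ k (cubeMs Mb K j)),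
      b'.1 ≠ b.1 → ∀ (lb : List ↥(Box d ℓ k (cubeMs Mb K j))), IsNNChain b lb → pathEnd b lb = b' →
      (lb.length : ℝ) ≤ ((d : ℝ) + 1) * supNorm (b'.1 - b.1) →
      ∀ Φ : ↥(Box d ℓ k (cubeMs Mb K j)) × ι → ℝ,
      ((((ℓ + 1) ^ k : ℕ) : ℝ) / supNorm (b'.1 - b.1)) ^ α *
        siteNorm (transport (fieldLink F (e / ((ℓ + 1) ^ k : ℕ))
              (cubeField (Box d ℓ k (cubeMs Mb K j)) ((ℓ + 1) ^ k) K (jloc j) (baseVal Mb K ((ℓ + 1) ^ k) Ac j)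
                (AcS j))) b lb
            *ᵥ fld (derivA d F (e / ((ℓ + 1) ^ k : ℕ)) ℓ k (cubeMs Mb K j)
                    (cubeField (Box d ℓ k (cubeMs Mb K j)) ((ℓ + 1) ^ k) K (jloc j) (baseVal Mb K ((ℓ + 1) ^ k) Ac j)
                      (AcS j)) μ
                  *ᵥ (greenA d F (e / ((ℓ + 1) ^ k : ℕ)) ℓ k a m2 (cubeMs Mb K j) (baseEmb hn _) (stairContour hn _)
                      (cubeField (Box d ℓ k (cubeMs Mb K j)) ((ℓ + 1) ^ k) K (jloc j) (baseVal Mb K ((ℓ + 1) ^ k) Ac j)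
                        (AcS j)) *ᵥ Φ)) b'
          - fld (derivA d F (e / ((ℓ + 1) ^ k : ℕ)) ℓ k (cubeMs Mb K j)
                    (cubeField (Box d ℓ k (cubeMs Mb K j)) ((ℓ + 1) ^ k) K (jloc j) (baseVal Mb K ((ℓ + 1) ^ k) Ac j)
                      (AcS j)) μ
                  *ᵥ (greenA d F (e / ((ℓ + 1) ^ k : ℕ)) ℓ k a m2 (cubeMs Mb K j) (baseEmb hn _) (stairContour hn _)
                      (cubeField (Box d ℓ k (cubeMs Mb K j)) ((ℓ + 1) ^ k) K (jloc j) (baseVal Mb K ((ℓ + 1) ^ k) Ac j)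
                        (AcS j)) *ᵥ Φ)) b)
        ≤ cH * supN Φ := by
    intro j hj b b' hbμ hb'μ hne' lb hlb hlbend hlblen Φ
    by_cases hint : IsInt Mb K j
    · have hin := fun μ => cubeMs_interior hK1 hKM hM hj hint μ
      rw [hbase j hint]
      have hb := h₃' k hk hn hnK a m2 ea1 ea2 em1 em2 (cubeMs Mb K j) (hMs1 j hj) (hMsS j hj) (jloc j)
        (fun μ => by rw [(hin μ).2]) (fun μ => by rw [(hin μ).1, (hin μ).2]; push_cast; omega)
        (AcS j) e he hle3 (hregS j) μ b ⟨b.1 + e1 μ, hbμ⟩ b' ⟨b'.1 + e1 μ, hb'μ⟩ rfl rfl hne' lb hlb hlbend hlblen Φ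
      exact hb.trans (mul_le_mul_of_nonneg_right (le_max_left _ _) (supN_nonneg Φ))
    · have hb := face_const (ℓ := ℓ) (k := k) hK1 hKM Ac hj hint hcol'
      rw [baseVal_of_not_isInt _ _ hint, transport_congr_nbrs F _ hb b lb hlb,
        derivA_congr_bonds F _ (cubeMs Mb K j) hb μ, greenA_congr_bonds F _ hn a m2 (cubeMs Mb K j) hb]
      exact (h₀'' k hk hn a m2 ea1 ea2 em1 em2 (cubeMs Mb K j) (hMs1 j hj) _ (Ac 0) μ b b' hbμ hb'μ hne' lb hlb hlbend
        hlblen Φ).trans (mul_le_mul_of_nonneg_right (le_max_right _ _) (supN_nonneg Φ))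
  have main := thm19_holder_boxCut_cubeField F hℓ hk hn hd Mb hM hK16 h4 hKM ha' em1 e Ac
    (baseVal Mb K ((ℓ + 1) ^ k) Ac) hcG hcD hcH hcK hG hDG hKG h3 μ x x' hxμ hx'μ hne hclose l hl hlend hlen hlnear
    hα0 hα1.le hHG P hD f hfP hφ hf i
  refine main.trans (mul_le_mul_of_nonneg_right (mul_le_mul_of_nonneg_right ?_ (Real.exp_pos _).le) hφ)
  rw [hc₁]
  linarith

/-- **THEOREM (1.9) OF [B4] ON A BOX, HÖLDER MEMBER, CLOSE PAIRS — FOR A (1.7)-REGULAR FIELD CONSTANT NEAR `∂Ω`, WITH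
«e SUFFICIENTLY SMALL» UNIFORM IN `Ω`, THE CONSTANT UNIFORM IN `η`** (pp.573–579, p.581; the print's cut cubes): for
`0 ≤ α < 1` there are `K` (`16 ≤ K`, `4 ∣ K`) and `c₁ > 0` such that for all `c ≥ 0`, `β > 0` there is `e₁ > 0` with —
for every `k ≥ 1`, `(a,m²) ∈ [a₋,a₊]×[0,m²₊]`, EVERY box `Ω = Π[0, nMb_μ)` (`K ∣ Mb_μ`, `1 ≤ Mb_μ`), component field `A`
with `|A_ν(x+e_μ) − A_ν(x)| ≤ c·e^{β−1}η` on `Ω` and `A = A(0)` on the `K`-collar at `∂Ω`, `0 < e ≤ e₁`, direction `μ`,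
fine sites `x ≠ x′` with `x+e_μ, x′+e_μ ∈ Ω`, `32|x′−x|_∞ ≤ nK`, a nearest-neighbour chain `Γ` from `x` to `x′` of length
`≤ (d+1)|x′−x|_∞` inside the `|x′−x|_∞`-ball about `x`, every `P` at unit-lattice sup-distance `≥ D` from `x`, every `f`
supported in `P` with `|f| ≤ φ` — `(n/|x′−x|_∞)^α·|U(A(Γ))(D^η_{A,μ}G_k(Ω,A)f)(x′) − (D^η_{A,μ}G_k(Ω,A)f)(x)|_i ≤
c₁·e^{−D/K}·φ`. [cite: Balaban1983RegularityDecay, Theorem (1.9) p.573; pp.575–579, p.581] -/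
theorem thm19_holder_box_uniform (F : OrthFlow ι) {ℓ₁ : ℝ} (hℓ₁ : 0 ≤ ℓ₁)
    (hLip : ∀ t (v : ι → ℝ), ((F.U t - 1) *ᵥ v) ⬝ᵥ ((F.U t - 1) *ᵥ v) ≤ (ℓ₁ * t) ^ 2 * (v ⬝ᵥ v))
    (d ℓ : ℕ) (hd : 1 ≤ d) (hℓ : 1 ≤ ℓ) (amin aplus m2plus : ℝ) (ha : 0 < amin) (α : ℝ) (hα0 : 0 ≤ α) (hα1 : α < 1) :
    ∃ K : ℕ, 16 ≤ K ∧ 4 ∣ K ∧ ∃ c₁ : ℝ, 0 < c₁ ∧ ∀ (creg β : ℝ), 0 ≤ creg → 0 < β →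
      ∃ e₁ : ℝ, 0 < e₁ ∧ ∀ (k : ℕ), 1 ≤ k → ∀ (hn : 1 ≤ (ℓ + 1) ^ k) (a m2 : ℝ),
      amin ≤ a → a ≤ aplus → 0 ≤ m2 → m2 ≤ m2plus →
      ∀ (Mb : Fin (d + 1) → ℕ), (∀ i, 1 ≤ Mb i) → (∀ μ, K ∣ Mb μ) →
      ∀ (Ac : (Fin (d + 1) → ℤ) → Fin (d + 1) → ℝ) (e : ℝ), 0 < e → e ≤ e₁ →
        (∀ x ∈ Box d ℓ k Mb, ∀ μ ν : Fin (d + 1),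
          |Ac (x + e1 μ) ν - Ac x ν| ≤ creg * e ^ (β - 1) / ((ℓ + 1) ^ k : ℕ)) →
        (∀ w ∈ Box d ℓ k Mb, (∃ μ, w μ < (((ℓ + 1) ^ k : ℕ) : ℤ) * K ∨
            (((ℓ + 1) ^ k : ℕ) : ℤ) * Mb μ < w μ + (((ℓ + 1) ^ k : ℕ) : ℤ) * K) → ∀ ν, Ac w ν = Ac 0 ν) →
      ∀ (μ : Fin (d + 1)) (x x' : ↥(Box d ℓ k Mb)), x.1 + e1 μ ∈ Box d ℓ k Mb → x'.1 + e1 μ ∈ Box d ℓ k Mb →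
        x'.1 ≠ x.1 → 32 * supNorm (x'.1 - x.1) ≤ (((ℓ + 1) ^ k : ℕ) : ℝ) * K →
      ∀ (l : List ↥(Box d ℓ k Mb)), IsNNChain x l → pathEnd x l = x' →
        (l.length : ℝ) ≤ ((d : ℝ) + 1) * supNorm (x'.1 - x.1) →
        (∀ z ∈ l, supNorm (z.1 - x.1) ≤ supNorm (x'.1 - x.1)) →
      ∀ (P : ↥(Box d ℓ k Mb) → Prop) [DecidablePred P] (D : ℝ),
        (∀ x'', P x'' → ∃ ν, D ≤ |posR ℓ k Mb x ν - posR ℓ k Mb x'' ν|) →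
      ∀ (f : ↥(Box d ℓ k Mb) × ι → ℝ), (∀ p, ¬ P p.1 → f p = 0) → ∀ (φ : ℝ), 0 ≤ φ → (∀ p, |f p| ≤ φ) →
      ∀ i : ι,
        ((((ℓ + 1) ^ k : ℕ) : ℝ) / supNorm (x'.1 - x.1)) ^ α *
          |(transport (fieldLink F (e / ((ℓ + 1) ^ k : ℕ)) (fun u v : ↥(Box d ℓ k Mb) => compField Ac u.1 v.1)) x l
              *ᵥ fld (derivA d F (e / ((ℓ + 1) ^ k : ℕ)) ℓ k Mb (fun u v : ↥(Box d ℓ k Mb) => compField Ac u.1 v.1) μ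
                    *ᵥ (greenA d F (e / ((ℓ + 1) ^ k : ℕ)) ℓ k a m2 Mb (baseEmb hn Mb) (stairContour hn Mb)
                        (fun u v : ↥(Box d ℓ k Mb) => compField Ac u.1 v.1) *ᵥ f)) x'
            - fld (derivA d F (e / ((ℓ + 1) ^ k : ℕ)) ℓ k Mb (fun u v : ↥(Box d ℓ k Mb) => compField Ac u.1 v.1) μ
                    *ᵥ (greenA d F (e / ((ℓ + 1) ^ k : ℕ)) ℓ k a m2 Mb (baseEmb hn Mb) (stairContour hn Mb)
                        (fun u v : ↥(Box d ℓ k Mb) => compField Ac u.1 v.1) *ᵥ f)) x) i|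
          ≤ c₁ * Real.exp (-(D / K)) * φ := by
  obtain ⟨K, hK, h4, H⟩ := thm19_holder_box_uniform_unifK F hℓ₁ hLip d ℓ hd hℓ amin aplus m2plus ha
  obtain ⟨c₁, hc₁, H'⟩ := H α hα0 hα1
  exact ⟨K, hK, h4, c₁, hc₁, H'⟩

/-! ## §2. (1.9) on a box, all pairs, hypothesis-free, uniform in `Ω` -/

/-- (v2, G-B4-p17-03: `K` CHOSEN BEFORE `α`; quantifiers `∃ K ∀ α ∃ c₁`.) **THEOREM (1.9) OF [B4] ON A BOX, HÖLDER MEMBER, ALL PAIRS — FOR A (1.7)-REGULAR FIELD CONSTANT NEAR `∂Ω`, «e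
SUFFICIENTLY SMALL» UNIFORM IN `Ω`, THE CONSTANT UNIFORM IN `η`**: for `0 ≤ α < 1` there are `K` (`16 ≤ K`, `4 ∣ K`) and
`c₁ > 0` such that for all `c ≥ 0`, `β > 0` there is `e₁ > 0` with — for every `k ≥ 1`, `(a,m²)` in the window, EVERY box
`Ω = Π[0, nMb_μ)` (`K ∣ Mb_μ`, `1 ≤ Mb_μ`), component field `A` (1.7)-regular on `Ω` with `A = A(0)` on the `K`-collar at
`∂Ω`, `0 < e ≤ e₁`, direction `μ`, fine sites `x ≠ x′` with `x+e_μ, x′+e_μ ∈ Ω`, ANY nearest-neighbour chain `Γ` from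
`x` to `x′` with `|Γ| ≤ (d+1)|x′−x|_∞` inside the `|x′−x|_∞`-ball about `x`, set `P` at unit-lattice sup-distance
`≥ D ≥ 0` from BOTH `x` and `x′`, source `f` supported in `P` with `|f| ≤ φ` —
`(n/|x′−x|_∞)^α·|U(A(Γ))(D^η_{A,μ}G_k(Ω,A)f)(x′) − (D^η_{A,μ}G_k(Ω,A)f)(x)|_i ≤ c₁·e^{−D/K}·φ` (close pairs: §1; far
pairs, p. 578: the uniform derivative member `thm110_deriv_box_uniform` at `x` and `x′` and `(n/r)^α ≤ 2`).
[cite: Balaban1983RegularityDecay, Theorem (1.9) p.573; (1.10) p.573; p.578; pp.575–579, p.581] -/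
theorem thm19_holder_box_uniform_all_unifK (F : OrthFlow ι) {ℓ₁ : ℝ} (hℓ₁ : 0 ≤ ℓ₁)
    (hLip : ∀ t (v : ι → ℝ), ((F.U t - 1) *ᵥ v) ⬝ᵥ ((F.U t - 1) *ᵥ v) ≤ (ℓ₁ * t) ^ 2 * (v ⬝ᵥ v))
    (d ℓ : ℕ) (hd : 1 ≤ d) (hℓ : 1 ≤ ℓ) (amin aplus m2plus : ℝ) (ha : 0 < amin) :
    ∃ K : ℕ, 16 ≤ K ∧ 4 ∣ K ∧ ∀ (α : ℝ), 0 ≤ α → α < 1 → ∃ c₁ : ℝ, 0 < c₁ ∧ ∀ (creg β : ℝ), 0 ≤ creg → 0 < β →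
      ∃ e₁ : ℝ, 0 < e₁ ∧ ∀ (k : ℕ), 1 ≤ k → ∀ (hn : 1 ≤ (ℓ + 1) ^ k) (a m2 : ℝ),
      amin ≤ a → a ≤ aplus → 0 ≤ m2 → m2 ≤ m2plus →
      ∀ (Mb : Fin (d + 1) → ℕ), (∀ i, 1 ≤ Mb i) → (∀ μ, K ∣ Mb μ) →
      ∀ (Ac : (Fin (d + 1) → ℤ) → Fin (d + 1) → ℝ) (e : ℝ), 0 < e → e ≤ e₁ →
        (∀ x ∈ Box d ℓ k Mb, ∀ μ ν : Fin (d + 1),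
          |Ac (x + e1 μ) ν - Ac x ν| ≤ creg * e ^ (β - 1) / ((ℓ + 1) ^ k : ℕ)) →
        (∀ w ∈ Box d ℓ k Mb, (∃ μ, w μ < (((ℓ + 1) ^ k : ℕ) : ℤ) * K ∨
            (((ℓ + 1) ^ k : ℕ) : ℤ) * Mb μ < w μ + (((ℓ + 1) ^ k : ℕ) : ℤ) * K) → ∀ ν, Ac w ν = Ac 0 ν) →
      ∀ (μ : Fin (d + 1)) (x x' : ↥(Box d ℓ k Mb)), x.1 + e1 μ ∈ Box d ℓ k Mb → x'.1 + e1 μ ∈ Box d ℓ k Mb →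
        x'.1 ≠ x.1 →
      ∀ (l : List ↥(Box d ℓ k Mb)), IsNNChain x l → pathEnd x l = x' →
        (l.length : ℝ) ≤ ((d : ℝ) + 1) * supNorm (x'.1 - x.1) →
        (∀ z ∈ l, supNorm (z.1 - x.1) ≤ supNorm (x'.1 - x.1)) →
      ∀ (P : ↥(Box d ℓ k Mb) → Prop) [DecidablePred P] (D : ℝ), 0 ≤ D →
        (∀ x'', P x'' → ∃ ν, D ≤ |posR ℓ k Mb x ν - posR ℓ k Mb x'' ν|) →
        (∀ x'', P x'' → ∃ ν, D ≤ |posR ℓ k Mb x' ν - posR ℓ k Mb x'' ν|) →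
      ∀ (f : ↥(Box d ℓ k Mb) × ι → ℝ), (∀ p, ¬ P p.1 → f p = 0) → ∀ (φ : ℝ), 0 ≤ φ → (∀ p, |f p| ≤ φ) →
      ∀ i : ι,
        ((((ℓ + 1) ^ k : ℕ) : ℝ) / supNorm (x'.1 - x.1)) ^ α *
          |(transport (fieldLink F (e / ((ℓ + 1) ^ k : ℕ)) (fun u v : ↥(Box d ℓ k Mb) => compField Ac u.1 v.1)) x l
              *ᵥ fld (derivA d F (e / ((ℓ + 1) ^ k : ℕ)) ℓ k Mb (fun u v : ↥(Box d ℓ k Mb) => compField Ac u.1 v.1) μ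
                    *ᵥ (greenA d F (e / ((ℓ + 1) ^ k : ℕ)) ℓ k a m2 Mb (baseEmb hn Mb) (stairContour hn Mb)
                        (fun u v : ↥(Box d ℓ k Mb) => compField Ac u.1 v.1) *ᵥ f)) x'
            - fld (derivA d F (e / ((ℓ + 1) ^ k : ℕ)) ℓ k Mb (fun u v : ↥(Box d ℓ k Mb) => compField Ac u.1 v.1) μ
                    *ᵥ (greenA d F (e / ((ℓ + 1) ^ k : ℕ)) ℓ k a m2 Mb (baseEmb hn Mb) (stairContour hn Mb)
                        (fun u v : ↥(Box d ℓ k Mb) => compField Ac u.1 v.1) *ᵥ f)) x) i|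
          ≤ c₁ * Real.exp (-(D / K)) * φ := by
  obtain ⟨K₁, hK₁, h4₁, HU⟩ := thm19_holder_box_uniform_unifK F hℓ₁ hLip d ℓ hd hℓ amin aplus m2plus ha
  obtain ⟨K₂, hK₂, -, c₂, hc₂, H₂⟩ := thm110_deriv_box_uniform F hℓ₁ hLip d ℓ hd hℓ amin aplus m2plus ha
  set K : ℕ := K₁ * K₂ with hK
  have hK₁K : K₁ ≤ K := by rw [hK]; nlinarith
  have hK₂K : K₂ ≤ K := by rw [hK]; nlinarith
  have hK16 : 16 ≤ K := hK₁.trans hK₁K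
  have h4 : 4 ∣ K := dvd_mul_of_dvd_left h4₁ K₂
  have hK₁r : (0 : ℝ) < K₁ := by exact_mod_cast lt_of_lt_of_le (by norm_num) hK₁
  have hK₂r : (0 : ℝ) < K₂ := by exact_mod_cast lt_of_lt_of_le (by norm_num) hK₂
  have hKr : (0 : ℝ) < K := by exact_mod_cast lt_of_lt_of_le (by norm_num) hK16
  refine ⟨K, hK16, h4, fun α hα0 hα1 => ?_⟩
  obtain ⟨c₁, hc₁, H₁⟩ := HU α hα0 hα1
  set c : ℝ := max c₁ (2 * (((Fintype.card ι : ℝ) + 1) * c₂)) with hc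
  refine ⟨c, lt_of_lt_of_le hc₁ (le_max_left _ _), fun creg β hcreg hβ => ?_⟩
  obtain ⟨e₁, he₁, H₁'⟩ := H₁ creg β hcreg hβ
  obtain ⟨e₂, he₂, H₂'⟩ := H₂ creg β hcreg hβ
  refine ⟨min e₁ e₂, lt_min he₁ he₂, ?_⟩
  intro k hk hn a m2 ea1 ea2 em1 em2 Mb hM hKM Ac e he hle h17 hcol μ x x' hxμ hx'μ hne l hl hlend hlen hlnear P _
    D hD0 hD hD' f hfP φ hφ hf i
  have hnr : (0 : ℝ) < (((ℓ + 1) ^ k : ℕ) : ℝ) := by exact_mod_cast hn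
  have hKM₁ : ∀ ν, K₁ ∣ Mb ν := fun ν => (Dvd.intro K₂ rfl).trans (hKM ν)
  have hKM₂ : ∀ ν, K₂ ∣ Mb ν := fun ν => (Dvd.intro_left K₁ rfl).trans (hKM ν)
  -- the collar of width `K` contains the collars of widths `K₁`, `K₂`
  have hcolW : ∀ K' : ℕ, K' ≤ K → ∀ w ∈ Box d ℓ k Mb, (∃ μ, w μ < (((ℓ + 1) ^ k : ℕ) : ℤ) * K' ∨
      (((ℓ + 1) ^ k : ℕ) : ℤ) * Mb μ < w μ + (((ℓ + 1) ^ k : ℕ) : ℤ) * K') → ∀ ν, Ac w ν = Ac 0 ν := by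
    intro K' hK' w hw hex
    refine hcol w hw ?_
    obtain ⟨ν, hν | hν⟩ := hex
    · refine ⟨ν, Or.inl (lt_of_lt_of_le hν ?_)⟩
      exact mul_le_mul_of_nonneg_left (by exact_mod_cast hK') (by positivity)
    · refine ⟨ν, Or.inr (lt_of_lt_of_le hν ?_)⟩
      have : (((ℓ + 1) ^ k : ℕ) : ℤ) * K' ≤ (((ℓ + 1) ^ k : ℕ) : ℤ) * K :=
        mul_le_mul_of_nonneg_left (by exact_mod_cast hK') (by positivity)
      linarith
  -- `e^{−D/Kᵢ} ≤ e^{−D/K}`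
  have hexpK : ∀ K' : ℕ, (0 : ℝ) < K' → K' ≤ K → Real.exp (-(D / K')) ≤ Real.exp (-(D / K)) := by
    intro K' hK'0 hK'
    refine Real.exp_le_exp.2 (neg_le_neg (div_le_div_of_nonneg_left hD0 hK'0 (by exact_mod_cast hK')))
  by_cases hclose : 32 * supNorm (x'.1 - x.1) ≤ (((ℓ + 1) ^ k : ℕ) : ℝ) * K₁
  · -- close pairs: the walk expansion
    have hb := H₁' k hk hn a m2 ea1 ea2 em1 em2 Mb hM hKM₁ Ac e he (hle.trans (min_le_left _ _)) h17
      (hcolW K₁ hK₁K) μ x x' hxμ hx'μ hne hclose l hl hlend hlen hlnear P D hD f hfP φ hφ hf i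
    exact hb.trans (mul_le_mul_of_nonneg_right (mul_le_mul (le_max_left _ _) (hexpK K₁ hK₁r hK₁K)
      (Real.exp_pos _).le (hc₁.le.trans (le_max_left _ _))) hφ)
  · -- far pairs: Hölder weight `≤ 2`, derivative member at `x` and at `x′`
    set r : ℝ := supNorm (x'.1 - x.1) with hr
    have hr0 : 0 < r := lt_of_lt_of_le zero_lt_one (one_le_supNorm_of_ne hne)
    have hw2 : ((((ℓ + 1) ^ k : ℕ) : ℝ) / r) ^ α ≤ 2 := by
      refine (rpow_le_max_one (div_nonneg hnr.le hr0.le) hα0 hα1.le).trans (max_le (by norm_num) ?_)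
      rw [div_le_iff₀ hr0]
      have hK₁16 : (16 : ℝ) ≤ K₁ := by exact_mod_cast hK₁
      push Not at hclose
      nlinarith
    have hx1 := H₂' k hk hn a m2 ea1 ea2 em1 em2 Mb hM hKM₂ Ac e he (hle.trans (min_le_right _ _)) h17
      (hcolW K₂ hK₂K) μ x hxμ P D hD f hfP φ hφ hf
    have hx2 := H₂' k hk hn a m2 ea1 ea2 em1 em2 Mb hM hKM₂ Ac e he (hle.trans (min_le_right _ _)) h17
      (hcolW K₂ hK₂K) μ x' hx'μ P D hD' f hfP φ hφ hf
    set Ψ := derivA d F (e / ((ℓ + 1) ^ k : ℕ)) ℓ k Mb (fun u v : ↥(Box d ℓ k Mb) => compField Ac u.1 v.1) μ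
      *ᵥ (greenA d F (e / ((ℓ + 1) ^ k : ℕ)) ℓ k a m2 Mb (baseEmb hn Mb) (stairContour hn Mb)
          (fun u v : ↥(Box d ℓ k Mb) => compField Ac u.1 v.1) *ᵥ f) with hΨ
    have hb0 : 0 ≤ c₂ * Real.exp (-(D / K₂)) * φ := by positivity
    have hU : |(transport (fieldLink F (e / ((ℓ + 1) ^ k : ℕ)) (fun u v : ↥(Box d ℓ k Mb) => compField Ac u.1 v.1))
        x l *ᵥ fld Ψ x') i| ≤ (Fintype.card ι : ℝ) * (c₂ * Real.exp (-(D / K₂)) * φ) := by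
      rw [transport_fieldLink]
      exact abs_U_mulVec_apply_le F _ _ hb0 (fun k' => hx2 k') i
    have hV : |fld Ψ x i| ≤ c₂ * Real.exp (-(D / K₂)) * φ := hx1 i
    have hdiff : |(transport (fieldLink F (e / ((ℓ + 1) ^ k : ℕ))
          (fun u v : ↥(Box d ℓ k Mb) => compField Ac u.1 v.1)) x l *ᵥ fld Ψ x' - fld Ψ x) i|
        ≤ ((Fintype.card ι : ℝ) + 1) * (c₂ * Real.exp (-(D / K₂)) * φ) := by
      rw [Pi.sub_apply]
      refine (abs_sub _ _).trans ?_
      linarith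
    have hw0 : 0 ≤ ((((ℓ + 1) ^ k : ℕ) : ℝ) / r) ^ α := Real.rpow_nonneg (div_nonneg hnr.le hr0.le) α
    calc ((((ℓ + 1) ^ k : ℕ) : ℝ) / r) ^ α
          * |(transport (fieldLink F (e / ((ℓ + 1) ^ k : ℕ)) (fun u v : ↥(Box d ℓ k Mb) => compField Ac u.1 v.1))
              x l *ᵥ fld Ψ x' - fld Ψ x) i|
        ≤ 2 * (((Fintype.card ι : ℝ) + 1) * (c₂ * Real.exp (-(D / K₂)) * φ)) :=
          mul_le_mul hw2 hdiff (abs_nonneg _) zero_le_two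
      _ = 2 * (((Fintype.card ι : ℝ) + 1) * c₂) * Real.exp (-(D / K₂)) * φ := by ring
      _ ≤ c * Real.exp (-(D / K)) * φ :=
          mul_le_mul_of_nonneg_right (mul_le_mul (le_max_right _ _) (hexpK K₂ hK₂r hK₂K) (Real.exp_pos _).le
            (hc₁.le.trans (le_max_left _ _))) hφ

/-- **THEOREM (1.9) OF [B4] ON A BOX, HÖLDER MEMBER, ALL PAIRS — FOR A (1.7)-REGULAR FIELD CONSTANT NEAR `∂Ω`, «e
SUFFICIENTLY SMALL» UNIFORM IN `Ω`, THE CONSTANT UNIFORM IN `η`**: for `0 ≤ α < 1` there are `K` (`16 ≤ K`, `4 ∣ K`) and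
`c₁ > 0` such that for all `c ≥ 0`, `β > 0` there is `e₁ > 0` with — for every `k ≥ 1`, `(a,m²)` in the window, EVERY box
`Ω = Π[0, nMb_μ)` (`K ∣ Mb_μ`, `1 ≤ Mb_μ`), component field `A` (1.7)-regular on `Ω` with `A = A(0)` on the `K`-collar at
`∂Ω`, `0 < e ≤ e₁`, direction `μ`, fine sites `x ≠ x′` with `x+e_μ, x′+e_μ ∈ Ω`, ANY nearest-neighbour chain `Γ` from
`x` to `x′` with `|Γ| ≤ (d+1)|x′−x|_∞` inside the `|x′−x|_∞`-ball about `x`, set `P` at unit-lattice sup-distance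
`≥ D ≥ 0` from BOTH `x` and `x′`, source `f` supported in `P` with `|f| ≤ φ` —
`(n/|x′−x|_∞)^α·|U(A(Γ))(D^η_{A,μ}G_k(Ω,A)f)(x′) − (D^η_{A,μ}G_k(Ω,A)f)(x)|_i ≤ c₁·e^{−D/K}·φ` (close pairs: §1; far
pairs, p. 578: the uniform derivative member `thm110_deriv_box_uniform` at `x` and `x′` and `(n/r)^α ≤ 2`).
[cite: Balaban1983RegularityDecay, Theorem (1.9) p.573; (1.10) p.573; p.578; pp.575–579, p.581] -/
theorem thm19_holder_box_uniform_all (F : OrthFlow ι) {ℓ₁ : ℝ} (hℓ₁ : 0 ≤ ℓ₁)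
    (hLip : ∀ t (v : ι → ℝ), ((F.U t - 1) *ᵥ v) ⬝ᵥ ((F.U t - 1) *ᵥ v) ≤ (ℓ₁ * t) ^ 2 * (v ⬝ᵥ v))
    (d ℓ : ℕ) (hd : 1 ≤ d) (hℓ : 1 ≤ ℓ) (amin aplus m2plus : ℝ) (ha : 0 < amin) (α : ℝ) (hα0 : 0 ≤ α) (hα1 : α < 1) :
    ∃ K : ℕ, 16 ≤ K ∧ 4 ∣ K ∧ ∃ c₁ : ℝ, 0 < c₁ ∧ ∀ (creg β : ℝ), 0 ≤ creg → 0 < β →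
      ∃ e₁ : ℝ, 0 < e₁ ∧ ∀ (k : ℕ), 1 ≤ k → ∀ (hn : 1 ≤ (ℓ + 1) ^ k) (a m2 : ℝ),
      amin ≤ a → a ≤ aplus → 0 ≤ m2 → m2 ≤ m2plus →
      ∀ (Mb : Fin (d + 1) → ℕ), (∀ i, 1 ≤ Mb i) → (∀ μ, K ∣ Mb μ) →
      ∀ (Ac : (Fin (d + 1) → ℤ) → Fin (d + 1) → ℝ) (e : ℝ), 0 < e → e ≤ e₁ →
        (∀ x ∈ Box d ℓ k Mb, ∀ μ ν : Fin (d + 1),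
          |Ac (x + e1 μ) ν - Ac x ν| ≤ creg * e ^ (β - 1) / ((ℓ + 1) ^ k : ℕ)) →
        (∀ w ∈ Box d ℓ k Mb, (∃ μ, w μ < (((ℓ + 1) ^ k : ℕ) : ℤ) * K ∨
            (((ℓ + 1) ^ k : ℕ) : ℤ) * Mb μ < w μ + (((ℓ + 1) ^ k : ℕ) : ℤ) * K) → ∀ ν, Ac w ν = Ac 0 ν) →
      ∀ (μ : Fin (d + 1)) (x x' : ↥(Box d ℓ k Mb)), x.1 + e1 μ ∈ Box d ℓ k Mb → x'.1 + e1 μ ∈ Box d ℓ k Mb →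
        x'.1 ≠ x.1 →
      ∀ (l : List ↥(Box d ℓ k Mb)), IsNNChain x l → pathEnd x l = x' →
        (l.length : ℝ) ≤ ((d : ℝ) + 1) * supNorm (x'.1 - x.1) →
        (∀ z ∈ l, supNorm (z.1 - x.1) ≤ supNorm (x'.1 - x.1)) →
      ∀ (P : ↥(Box d ℓ k Mb) → Prop) [DecidablePred P] (D : ℝ), 0 ≤ D →
        (∀ x'', P x'' → ∃ ν, D ≤ |posR ℓ k Mb x ν - posR ℓ k Mb x'' ν|) →
        (∀ x'', P x'' → ∃ ν, D ≤ |posR ℓ k Mb x' ν - posR ℓ k Mb x'' ν|) →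
      ∀ (f : ↥(Box d ℓ k Mb) × ι → ℝ), (∀ p, ¬ P p.1 → f p = 0) → ∀ (φ : ℝ), 0 ≤ φ → (∀ p, |f p| ≤ φ) →
      ∀ i : ι,
        ((((ℓ + 1) ^ k : ℕ) : ℝ) / supNorm (x'.1 - x.1)) ^ α *
          |(transport (fieldLink F (e / ((ℓ + 1) ^ k : ℕ)) (fun u v : ↥(Box d ℓ k Mb) => compField Ac u.1 v.1)) x l
              *ᵥ fld (derivA d F (e / ((ℓ + 1) ^ k : ℕ)) ℓ k Mb (fun u v : ↥(Box d ℓ k Mb) => compField Ac u.1 v.1) μ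
                    *ᵥ (greenA d F (e / ((ℓ + 1) ^ k : ℕ)) ℓ k a m2 Mb (baseEmb hn Mb) (stairContour hn Mb)
                        (fun u v : ↥(Box d ℓ k Mb) => compField Ac u.1 v.1) *ᵥ f)) x'
            - fld (derivA d F (e / ((ℓ + 1) ^ k : ℕ)) ℓ k Mb (fun u v : ↥(Box d ℓ k Mb) => compField Ac u.1 v.1) μ
                    *ᵥ (greenA d F (e / ((ℓ + 1) ^ k : ℕ)) ℓ k a m2 Mb (baseEmb hn Mb) (stairContour hn Mb)
                        (fun u v : ↥(Box d ℓ k Mb) => compField Ac u.1 v.1) *ᵥ f)) x) i|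
          ≤ c₁ * Real.exp (-(D / K)) * φ := by
  obtain ⟨K, hK, h4, H⟩ := thm19_holder_box_uniform_all_unifK F hℓ₁ hLip d ℓ hd hℓ amin aplus m2plus ha
  obtain ⟨c₁, hc₁, H'⟩ := H α hα0 hα1
  exact ⟨K, hK, h4, c₁, hc₁, H'⟩

end

end Literature.MathematicalPhysics.QuantumFieldTheory.Balaban1983to89.B4Thm19BoxHolderUniform
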